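import Summits.BirchSwinnertonDyer.BirchSwinnertonDyer.Theorems.SignedLowerHalvesSmallImageLowerHalfBothSignsRttCharRoadE2GlueAlgebra
import Mathlib.RingTheory.TensorProduct.Free
import Mathlib.RingTheory.TensorProduct.Maps
import HarnessLib

/-!
# Route `SignedLowerHalves`, crux L `SmallImageLowerHalfBothSigns` (stmt-BirchSwinnertonDyer-23599), line `rtt_w3` v13 — E2, LEAD:
# `Λ_𝒪 = 𝒪⟦T⟧`-STRUCTURES FROM COMMUTING `Λ`- AND `𝒪`-ACTIONS (`Λ_𝒪 ≅ Λ ⊗_{ℤ_p} 𝒪`), for the carriers `X' := Dψ.X` and `Q` of the glue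

WHY (BRIEF-E2 rev 3.1 §2, `Lines/rtt_w3-BRIEF-E2-g9b.md`). The glue in localisation form `charRoad_E2_of_localisation` (p776213) wants its carriers `Q`
(dual of the saturated local condition) and `X'` (`:= Dψ.X`, the dual of the saturated transported signed Selmer group) as `Λ_𝒪 = IwasawaAlgebraO S`-MODULES
whose `Λ = ℤ_p⟦T⟧`-structure through `iwasawaToIwasawaO S` is the given one. What the tree's dual data carry is LESS: a `Λ`-structure (`T ↦ conj_γ − 1`,
`IwasawaDual.IsLocNil.module`) and a COMMUTING `𝒪 = padicCoeffIntegers S`-action (transport of `scalarH1`, `conjH1_comp_scalarH1`). This file closes the gap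
once and for all, in pure algebra: because `𝒪` is finite free over `ℤ_p`, the natural map `Λ ⊗_{ℤ_p} 𝒪 → Λ_𝒪`, `f ⊗ a ↦ ι(f)·C(a)`, is a RING ISOMORPHISM,
and commuting `Λ`/`𝒪`-structures agreeing on `ℤ_p` are ONE `Λ ⊗_{ℤ_p} 𝒪`-structure (Mathlib `TensorProduct.Algebra.module`), hence ONE `Λ_𝒪`-structure:
* `moduleFree_finite_padicCoeffIntegers` — `𝒪` is finite free over `ℤ_p` (through `padicIntToCoeffIntegers`; transport from the unit ball);
* ★ `bijective_tensorToIwasawaAlgebraO` — `Λ ⊗_{ℤ_p} 𝒪 → Λ_𝒪` (the `Algebra.TensorProduct.lift` of `iwasawaToIwasawaO S` and `C`) is bijective;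
* ★★ `exists_module_iwasawaAlgebraO` — for an abelian group `X` with `[Module Λ X]`, `[Module 𝒪 X]`, commuting, and `(C c)•x = (ι₀ c)•x` for `c ∈ ℤ_p`:
  THERE IS a `Module Λ_𝒪 X` with `(iwasawaToIwasawaO S f)•x = f•x` and `(C a)•x = a•x` (hence `IsScalarTower Λ Λ_𝒪 X` for any `[Algebra Λ Λ_𝒪]` with
  `algebraMap = iwasawaToIwasawaO S`, `isScalarTower_iwasawaAlgebraO_of_smul_eq`). Stated as an `∃` over structures (THEOREMS ONLY — no definition, no instance): the
  consumer writes `obtain ⟨inst, hΛ, h𝒪⟩ := …; letI := inst`.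
Nothing about `BirchSwinnertonDyer`, crux L or E2 is proved here. [cite: Washington1997, §13.2] [folklore]
-/

set_option linter.dupNamespace false -- D-0017: single-problem summit, the namespace repeats the problem name by design
set_option autoImplicit false

noncomputable section

open scoped TensorProduct

namespace Summit.BirchSwinnertonDyer.BirchSwinnertonDyer.Theorems.SmallImageRttCharRoad

open PowerSeries Literature.NumberTheory.EllipticCurves

universe u

variable {p : ℕ} [Fact p.Prime] (S : Set (PadicAlgCl p)) [FiniteDimensional ℚ_[p] (padicCoeffField S)]

/-- **`𝒪 = padicCoeffIntegers S` is a finite free `ℤ_p`-module** (`[ℚ_p(S):ℚ_p] < ∞`), for the algebra structure through `padicIntToCoeffIntegers S`: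
transport from the unit ball `𝒪_{ℚ_p(S)}` (`padicCoeffIntegers_eq_unitBall`, `PadicIntermediateField.moduleFree_unitBall`). [cite: NeukirchANT1999, Ch. II (6.8)] -/
theorem moduleFree_finite_padicCoeffIntegers :
    letI : Algebra ℤ_[p] (padicCoeffIntegers S) := (padicIntToCoeffIntegers S).toAlgebra
    Module.Free ℤ_[p] (padicCoeffIntegers S) ∧ Module.Finite ℤ_[p] (padicCoeffIntegers S) := by
  letI : Algebra ℤ_[p] (padicCoeffIntegers S) := (padicIntToCoeffIntegers S).toAlgebra
  let E := padicCoeffField S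
  let eR : padicCoeffIntegers S ≃+* Literature.NumberTheory.Automorphic.PadicIntermediateField.unitBall p E :=
    RingEquiv.subringCongr (padicCoeffIntegers_eq_unitBall S)
  let eL : padicCoeffIntegers S ≃ₗ[ℤ_[p]] Literature.NumberTheory.Automorphic.PadicIntermediateField.unitBall p E :=
    { eR with
      map_smul' := fun c x ↦ by
        refine Subtype.ext ?_
        change ((eR (c • x) : _) : PadicAlgCl p) = ((c • eR x : _) : PadicAlgCl p)
        rw [Algebra.smul_def, Algebra.smul_def, map_mul, Subring.coe_mul, Subring.coe_mul]
        congr 1 }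
  exact ⟨Module.Free.of_equiv eL.symm, Module.Finite.equiv eL.symm⟩

/-- **`Λ ⊗_{ℤ_p} 𝒪 ≅ Λ_𝒪`**: the algebra map `f ⊗ a ↦ iwasawaToIwasawaO S f · C a` (`Algebra.TensorProduct.lift`) is BIJECTIVE — a `ℤ_p`-basis `(b_i)` of `𝒪`
gives the `Λ`-basis `1 ⊗ b_i` of `Λ ⊗ 𝒪` and, coefficientwise, the `Λ`-basis `C b_i` of `𝒪⟦T⟧`. (The `Algebra ℤ_p 𝒪` structure is the one through
`padicIntToCoeffIntegers S`, installed with `letI` in the statement.) [folklore] -/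
theorem bijective_tensorToIwasawaAlgebraO :
    letI : Algebra ℤ_[p] (padicCoeffIntegers S) := (padicIntToCoeffIntegers S).toAlgebra
    ∃ φ : IwasawaAlgebra p ⊗[ℤ_[p]] padicCoeffIntegers S →ₐ[ℤ_[p]] IwasawaAlgebraO S,
      Function.Bijective φ ∧ ∀ (f : IwasawaAlgebra p) (a : padicCoeffIntegers S),
        φ (f ⊗ₜ a) = iwasawaToIwasawaO S f * PowerSeries.C a := by
  classical
  letI algO : Algebra ℤ_[p] (padicCoeffIntegers S) := (padicIntToCoeffIntegers S).toAlgebra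
  obtain ⟨hfree, hfin⟩ := moduleFree_finite_padicCoeffIntegers S
  haveI := hfree
  haveI := hfin
  -- the two algebra maps and their lift
  let gΛ : IwasawaAlgebra p →ₐ[ℤ_[p]] IwasawaAlgebraO S :=
    { iwasawaToIwasawaO S with
      commutes' := fun c ↦ by
        change iwasawaToIwasawaO S (algebraMap ℤ_[p] (IwasawaAlgebra p) c) = algebraMap ℤ_[p] (IwasawaAlgebraO S) c
        rw [PowerSeries.algebraMap_apply, Algebra.algebraMap_self_apply, PowerSeries.algebraMap_apply, iwasawaToIwasawaO,
          PowerSeries.map_C, RingHom.algebraMap_toAlgebra] }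
  let gO : padicCoeffIntegers S →ₐ[ℤ_[p]] IwasawaAlgebraO S :=
    { (PowerSeries.C : padicCoeffIntegers S →+* IwasawaAlgebraO S) with
      commutes' := fun c ↦ by
        change PowerSeries.C (algebraMap ℤ_[p] (padicCoeffIntegers S) c) = algebraMap ℤ_[p] (IwasawaAlgebraO S) c
        rw [PowerSeries.algebraMap_apply] }
  let φ : IwasawaAlgebra p ⊗[ℤ_[p]] padicCoeffIntegers S →ₐ[ℤ_[p]] IwasawaAlgebraO S :=
    Algebra.TensorProduct.lift gΛ gO fun _ _ ↦ Commute.all _ _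
  have hφ : ∀ (f : IwasawaAlgebra p) (a : padicCoeffIntegers S), φ (f ⊗ₜ a) = iwasawaToIwasawaO S f * PowerSeries.C a :=
    fun f a ↦ Algebra.TensorProduct.lift_tmul _ _ _ f a
  refine ⟨φ, ⟨?_, ?_⟩, hφ⟩
  · -- injective: read off coefficientwise against a basis
    let b := Module.Free.chooseBasis ℤ_[p] (padicCoeffIntegers S)
    let bT := Algebra.TensorProduct.basis (IwasawaAlgebra p) b
    rw [injective_iff_map_eq_zero]
    intro t ht
    -- coordinates of `t`
    have hsum : t = ∑ i, bT.repr t i • bT i := (bT.sum_repr t).symm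
    have hφt : φ t = ∑ i, iwasawaToIwasawaO S (bT.repr t i) * PowerSeries.C (b i) := by
      conv_lhs => rw [hsum]
      rw [map_sum]
      refine Finset.sum_congr rfl fun i _ ↦ ?_
      rw [Algebra.TensorProduct.basis_repr_symm_apply', hφ]
    -- every coefficient of every coordinate vanishes
    have hcoord : ∀ i, bT.repr t i = 0 := by
      have hk : ∀ k : ℕ, ∀ i, PowerSeries.coeff k (bT.repr t i) = 0 := fun k ↦ by
        have h0 : ∑ i, (PowerSeries.coeff k (bT.repr t i)) • b i = 0 := by
          have := congrArg (PowerSeries.coeff k) (ht.symm.trans hφt)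
          rw [map_zero, map_sum] at this
          rw [this]
          refine Finset.sum_congr rfl fun i _ ↦ ?_
          rw [PowerSeries.coeff_mul_C, iwasawaToIwasawaO, PowerSeries.coeff_map, Algebra.smul_def, RingHom.algebraMap_toAlgebra]
        exact fun i ↦ Fintype.linearIndependent_iff.mp b.linearIndependent _ h0 i
      intro i
      exact PowerSeries.ext fun k ↦ by rw [hk k i, map_zero]
    rw [hsum]
    exact Finset.sum_eq_zero fun i _ ↦ by rw [hcoord i, zero_smul]
  · -- surjective: coefficientwise coordinates
    let b := Module.Free.chooseBasis ℤ_[p] (padicCoeffIntegers S)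
    intro F
    let r : Module.Free.ChooseBasisIndex ℤ_[p] (padicCoeffIntegers S) → IwasawaAlgebra p :=
      fun i ↦ PowerSeries.mk fun k ↦ b.repr (PowerSeries.coeff k F) i
    refine ⟨∑ i, r i ⊗ₜ b i, ?_⟩
    rw [map_sum]
    refine PowerSeries.ext fun k ↦ ?_
    rw [map_sum]
    have hterm : ∀ i, PowerSeries.coeff k (φ (r i ⊗ₜ b i)) = (b.repr (PowerSeries.coeff k F) i) • b i := fun i ↦ by
      rw [hφ, PowerSeries.coeff_mul_C, iwasawaToIwasawaO, PowerSeries.coeff_map, PowerSeries.coeff_mk, Algebra.smul_def,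
        RingHom.algebraMap_toAlgebra]
    simp_rw [hterm]
    exact b.sum_repr (PowerSeries.coeff k F)

/-- **A `Λ_𝒪`-structure from commuting `Λ`- and `𝒪`-structures.** Let `X` carry a `Λ = ℤ_p⟦T⟧`-module structure and an `𝒪 = padicCoeffIntegers S`-module
structure which COMMUTE and AGREE ON `ℤ_p` (`(C c)•x = (ι₀ c)•x`). Then there is a `Λ_𝒪 = 𝒪⟦T⟧`-module structure on `X` with
`(iwasawaToIwasawaO S f)•x = f•x` and `(C a)•x = a•x` — the `Λ ⊗_{ℤ_p} 𝒪`-structure of Mathlib's `TensorProduct.Algebra.module` transported along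
`Λ ⊗_{ℤ_p} 𝒪 ≅ Λ_𝒪` (`bijective_tensorToIwasawaAlgebraO`). An `∃` over structures; install with `obtain ⟨inst, hΛ, h𝒪⟩ := …; letI := inst`.
(Use: `X := Dψ.X` with the `𝒪`-action transported from `scalarH1` through `toDual`; `X := Q`, the dual of the saturated local condition.) [folklore] -/
theorem exists_module_iwasawaAlgebraO {X : Type u} [AddCommGroup X] [Module (IwasawaAlgebra p) X] [Module (padicCoeffIntegers S) X]
    (hcomm : ∀ (a : padicCoeffIntegers S) (f : IwasawaAlgebra p) (x : X), a • f • x = f • a • x)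
    (hC : ∀ (c : ℤ_[p]) (x : X), (PowerSeries.C c : IwasawaAlgebra p) • x = padicIntToCoeffIntegers S c • x) :
    ∃ inst : Module (IwasawaAlgebraO S) X,
      (∀ (f : IwasawaAlgebra p) (x : X), (letI := inst; iwasawaToIwasawaO S f • x) = f • x) ∧
      (∀ (a : padicCoeffIntegers S) (x : X), (letI := inst; (PowerSeries.C a : IwasawaAlgebraO S) • x) = a • x) := by
  classical
  letI algO : Algebra ℤ_[p] (padicCoeffIntegers S) := (padicIntToCoeffIntegers S).toAlgebra
  obtain ⟨φ, hbij, hφ⟩ := bijective_tensorToIwasawaAlgebraO S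
  -- the `ℤ_p`-structure of `X` through the constants of `Λ`, compatible with both actions
  letI modZ : Module ℤ_[p] X := Module.compHom X (algebraMap ℤ_[p] (IwasawaAlgebra p))
  haveI : IsScalarTower ℤ_[p] (IwasawaAlgebra p) X := IsScalarTower.of_compHom _ _ _
  haveI : IsScalarTower ℤ_[p] (padicCoeffIntegers S) X := ⟨fun c a x ↦ by
    change (c • a) • x = (algebraMap ℤ_[p] (IwasawaAlgebra p) c) • (a • x)
    rw [Algebra.smul_def, RingHom.algebraMap_toAlgebra, mul_smul, PowerSeries.algebraMap_apply, Algebra.algebraMap_self_apply, hC]⟩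
  haveI : SMulCommClass (IwasawaAlgebra p) (padicCoeffIntegers S) X := ⟨fun f a x ↦ (hcomm a f x).symm⟩
  letI modT : Module (IwasawaAlgebra p ⊗[ℤ_[p]] padicCoeffIntegers S) X := TensorProduct.Algebra.module
  let e : (IwasawaAlgebra p ⊗[ℤ_[p]] padicCoeffIntegers S) ≃ₐ[ℤ_[p]] IwasawaAlgebraO S := AlgEquiv.ofBijective φ hbij
  have he : ∀ t, e t = φ t := fun _ ↦ rfl
  refine ⟨Module.compHom X (e.symm : IwasawaAlgebraO S ≃ₐ[ℤ_[p]] _).toRingEquiv.toRingHom, fun f x ↦ ?_, fun a x ↦ ?_⟩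
  · have h1 : e.symm (iwasawaToIwasawaO S f) = f ⊗ₜ (1 : padicCoeffIntegers S) := by
      rw [AlgEquiv.symm_apply_eq, he, hφ, map_one, mul_one]
    change (e.symm (iwasawaToIwasawaO S f)) • x = f • x
    rw [h1, TensorProduct.Algebra.smul_def, one_smul]
  · have h1 : e.symm (PowerSeries.C a) = (1 : IwasawaAlgebra p) ⊗ₜ a := by
      rw [AlgEquiv.symm_apply_eq, he, hφ, map_one, one_mul]
    change (e.symm (PowerSeries.C a)) • x = a • x
    rw [h1, TensorProduct.Algebra.smul_def, one_smul]

omit [FiniteDimensional ℚ_[p] (padicCoeffField S)] in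
/-- **The scalar tower follows**: if a `Λ_𝒪`-structure on `X` satisfies `(iwasawaToIwasawaO S f)•x = f•x`, then for ANY `[Algebra Λ Λ_𝒪]` with
`algebraMap = iwasawaToIwasawaO S` (the glue's context) `IsScalarTower Λ Λ_𝒪 X` holds. [folklore] -/
theorem isScalarTower_iwasawaAlgebraO_of_smul_eq {X : Type u} [AddCommGroup X] [Module (IwasawaAlgebra p) X] [Module (IwasawaAlgebraO S) X]
    [Algebra (IwasawaAlgebra p) (IwasawaAlgebraO S)]
    (halg : ∀ r : IwasawaAlgebra p, algebraMap (IwasawaAlgebra p) (IwasawaAlgebraO S) r = iwasawaToIwasawaO S r)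
    (hΛ : ∀ (f : IwasawaAlgebra p) (x : X), iwasawaToIwasawaO S f • x = f • x) :
    IsScalarTower (IwasawaAlgebra p) (IwasawaAlgebraO S) X :=
  ⟨fun f g x ↦ by rw [Algebra.smul_def, halg, mul_smul, hΛ]⟩

end Summit.BirchSwinnertonDyer.BirchSwinnertonDyer.Theorems.SmallImageRttCharRoad

end
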